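import Mathlib
import Literature.Analysis.FluidPDE.ClassicalSolution
import Literature.Analysis.FluidPDE.LerayHopf
import Literature.Analysis.FluidPDE.SereginSverakPressureLocalTypeI
import Summits.NavierStokesRegularity.NavierStokesRegularity.Theses.L3TimeExponentPincer
import Summits.NavierStokesRegularity.NavierStokesRegularity.Theorems.L3TimeExponentPincerEffNode
import Summits.NavierStokesRegularity.NavierStokesRegularity.Theorems.L3TimeExponentPincerPaceDichotomy
import Summits.NavierStokesRegularity.NavierStokesRegularity.Theorems.L3TimeExponentPincerMorreyTypeICentred
import HarnessLib.Audit
import HarnessLib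

/-!
# Local time-averaged `L³`-Type-I pace and Type-I dissipation of Morrey-Type-I frame solutions
# — crux `EffSatBlowup`, line `pace`, stub 2's class (route `L3TimeExponentPincer`, item
# `stmt-NavierStokesRegularity-19139`)

Support file (seat ns-pincer-19139-p1, lead of line `pace`; `--supports stmt-NavierStokesRegularity-19139
--as helper`), companion of `L3TimeExponentPincerMorreyTypeICentred.lean` (Seregin's centred Type-I bounds
`A + E + C + D ≤ K` at every point of the final slice of a Morrey-Type-I frame solution, on the unit-viscosity
zoom, with a uniform constant).  Here those bounds are unpacked into the frame's own currency, uniformly over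
centres `x₀` and radii `0 < ρ ≤ ρ₀`:

* §3 `exists_local_l3Pace_of_morreyTypeINear` — `∫_{T-ρ²/ν}^{T} ∫_{B(x₀,ρ)} |u|³ dx dt ≤ K ρ²`: **the `L³`-Type-I
  PACE of stub 2 holds in the Caffarelli–Kohn–Nirenberg time-averaged local sense**
  `sup_{x₀, ρ ≤ ρ₀} C((T,x₀), ρ) < ∞`, `C(ρ) = ρ⁻² ∫∫_{Q_ρ} |u|³` (viscous cylinders `(T-ρ²/ν, T) × B(x₀,ρ)`);
  `exists_local_dissipation_of_morreyTypeINear` — `∫_{T-ρ²/ν}^{T} ∫_{B(x₀,ρ)} |∇u|² ≤ K ρ`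
  (`sup E((T,x₀), ρ) < ∞`: dissipation is Type I on average on every top cylinder).
* §4 the same two statements with the hypotheses of the registered stub `stub_morreyTypeI_slow` spelled out
  (`…_on_stub2_class`), so that the item's helper cone records them against stub 2's class.

Placement for the line (honest): stub 2 asks for `‖u(t)‖³_{L³(ℝ³)} ≤ A/√(T-t)` at EVERY late time (`L3Slow`);
§3 gives the same exponent only (i) averaged over each top window `(T-ρ²/ν, T)` and (ii) ball by ball.  The two
named gaps — time intermittency of `‖u(t)‖₃` inside a top window, and the spatial multiplicity of concentration
balls — are what remains of stub 2 on top of this file; neither is in print.  No blow-up hypothesis is used.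

WHAT THIS IS NOT: not a claim about Navier–Stokes regularity or blow-up; printed estimates (Seregin 2006/2007,
Caffarelli–Kohn–Nirenberg scaled quantities) assembled in the route's frame, kernel-checked, landed `--supports`;
the crux `EffSatBlowup` and stubs 2–3 of line `pace` stay open.

References: G. Seregin, J. Math. Sci. 143 (2007) = arXiv:math/0607537, Lemma 2.1 (c) [Seregin2006];
L. Caffarelli, R. Kohn, L. Nirenberg, CPAM 35 (1982), §2 [CaffarelliKohnNirenberg1982]; T. Barker, C. Prange,
ARMA 236 (2020) = arXiv:1812.09115, (1.7) [BarkerPrange2020].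
-/

noncomputable section

open MeasureTheory Set Function Filter Metric Topology TopologicalSpace
open scoped ENNReal NNReal Topology
open Literature.Analysis.FluidPDE
open Literature.Analysis.FluidPDE.SereginSverak2002
open Summit.NavierStokesRegularity.NavierStokesRegularity.Theorems.L3TimeExponentPincerEffNode
open Summit.NavierStokesRegularity.NavierStokesRegularity.Theorems.L3TimeExponentPincerPaceDichotomy
open Summit.NavierStokesRegularity.NavierStokesRegularity.Theorems.L3TimeExponentPincerMorreyTypeICentred

namespace Summit.NavierStokesRegularity.NavierStokesRegularity.Theorems.L3TimeExponentPincerMorreyTypeILocalPace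

variable {ν T : ℝ} {u : ℝ → EuclideanSpace ℝ (Fin 3) → EuclideanSpace ℝ (Fin 3)}
  {p : ℝ → EuclideanSpace ℝ (Fin 3) → ℝ}

/-! ## §3  Consequences in the frame's currency: local `L³` pace and local dissipation on every top cylinder -/

/-- **Local time-averaged `L³`-Type-I pace of Morrey-Type-I frame solutions.**  Under the hypotheses of
`exists_zoom_sereginBounds_of_morreyTypeINear` there are `K, ρ₀ > 0` with
`∫_{T-ρ²/ν}^{T} ∫_{B(x₀,ρ)} |u|³ dx dt ≤ K ρ²` for EVERY centre `x₀` and every `0 < ρ ≤ ρ₀` — i.e.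
`sup_{x₀, ρ ≤ ρ₀} C((T,x₀), ρ) < ∞` for the Caffarelli–Kohn–Nirenberg quantity `C(ρ) = ρ⁻² ∫∫_{Q_ρ} |u|³`
(viscous cylinders).  Stub 2 of line `pace` asks for the slice-wise, whole-space version `‖u(t)‖₃³ ≤ A/√(T-t)`.
[cite: Seregin2006, Lemma 2.1 (c) (arXiv:math/0607537 §2)] [cite: CaffarelliKohnNirenberg1982, §2] -/
theorem exists_local_l3Pace_of_morreyTypeINear (hν : 0 < ν) (hT : 0 < T)
    (hsol : IsClassicalNSSolutionOn (Ico 0 T) ν 0 u p) (hLH : IsLerayHopfOn T ν 0 (u 0) u)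
    (hMor : MorreyTypeINear u T) :
    ∃ K : ℝ, 0 < K ∧ ∃ ρ₀ : ℝ, 0 < ρ₀ ∧ ∀ (x₀ : EuclideanSpace ℝ (Fin 3)) (ρ : ℝ), 0 < ρ → ρ ≤ ρ₀ →
      ∫⁻ z in Ioo (T - ρ ^ 2 / ν) T ×ˢ ball x₀ ρ, ‖u z.1 z.2‖ₑ ^ (3 : ℕ) ≤ ENNReal.ofReal (K * ρ ^ 2) := by
  obtain ⟨R, hRpos, -, K, hK⟩ := exists_zoom_sereginBounds_of_morreyTypeINear hν hT hsol hLH hMor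
  set α : ℝ := R / ν with hα
  set β : ℝ := R ^ 2 / ν with hβdef
  have hαpos : 0 < α := by positivity
  have hβpos : 0 < β := by positivity
  -- the scaling constant of `C` under the zoom
  have hc0 : (‖α‖ₑ ^ (3 : ℝ) * ENNReal.ofReal (β * R ^ 3)⁻¹ : ℝ≥0∞) ≠ 0 := by
    refine mul_ne_zero ?_ ?_
    · exact (ENNReal.rpow_pos (enorm_pos.2 hαpos.ne') enorm_ne_top).ne'
    · exact (ENNReal.ofReal_pos.2 (by positivity)).ne'
  have hct : (‖α‖ₑ ^ (3 : ℝ) * ENNReal.ofReal (β * R ^ 3)⁻¹ : ℝ≥0∞) ≠ ∞ :=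
    ENNReal.mul_ne_top (ENNReal.rpow_ne_top_of_nonneg (by norm_num) enorm_ne_top) ENNReal.ofReal_ne_top
  have hcK : ((‖α‖ₑ ^ (3 : ℝ) * ENNReal.ofReal (β * R ^ 3)⁻¹)⁻¹ * (K : ℝ≥0∞)) ≠ ∞ :=
    ENNReal.mul_ne_top (ENNReal.inv_ne_top.2 hc0) ENNReal.coe_ne_top
  set K' : ℝ := ((‖α‖ₑ ^ (3 : ℝ) * ENNReal.ofReal (β * R ^ 3)⁻¹)⁻¹ * (K : ℝ≥0∞)).toReal / R ^ 2 + 1 with hK'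
  refine ⟨K', by positivity, R / 2, by positivity, fun x₀ ρ hρ hρR => ?_⟩
  -- `ρ = R r` with `0 < r ≤ 1/2`
  set r : ℝ := ρ / R with hr
  have hrpos : 0 < r := by positivity
  have hrhalf : r ≤ 1 / 2 := by
    rw [hr, div_le_iff₀ hRpos]; linarith
  have hρeq : R * r = ρ := by rw [hr]; field_simp
  have hK' := hK x₀ r ⟨hrpos, hrhalf⟩
  have hC : cknC r 0 (α • stPull β R T x₀ u) ≤ K := le_add_self.trans (le_self_add.trans hK')
  -- unpack `C(r)` of the zoom
  have hpre : parabolicCylinder r (0 : ℝ × EuclideanSpace ℝ (Fin 3)) =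
      stAffine β R T x₀ ⁻¹' (Ioo (T - ρ ^ 2 / ν) T ×ˢ ball x₀ ρ) := by
    rw [← hρeq, hβdef, stAffine_preimage_cylinder_eq_parabolicCylinder hν hRpos T x₀ (R * r),
      mul_div_cancel_left₀ r hRpos.ne']
    rfl
  unfold cknC at hC
  rw [setLIntegral_enorm_pow_three_eq_rpow, hpre,
    setLIntegral_enorm_rpow_stRescale hβpos hRpos T x₀ α u _ (by norm_num : (0:ℝ) ≤ 3),
    finrank_euclideanSpace_fin, ← setLIntegral_enorm_pow_three_eq_rpow] at hC
  have ha0 : ENNReal.ofReal r ^ 2 ≠ 0 := pow_ne_zero _ (ENNReal.ofReal_pos.2 hrpos).ne'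
  have hat : ENNReal.ofReal r ^ 2 ≠ ∞ := ENNReal.pow_ne_top ENNReal.ofReal_ne_top
  have h1 := le_of_inv_mul_mul_le ha0 hat hc0 hct hC
  refine h1.trans ?_
  -- `c⁻¹ K (ofReal r)² = ofReal ((c⁻¹K).toReal r²) ≤ ofReal (K' ρ²)`
  rw [← ENNReal.ofReal_pow hrpos.le, ← ENNReal.ofReal_toReal hcK, ← ENNReal.ofReal_mul ENNReal.toReal_nonneg]
  refine ENNReal.ofReal_le_ofReal ?_
  set L : ℝ := (((‖α‖ₑ ^ (3 : ℝ) * ENNReal.ofReal (β * R ^ 3)⁻¹)⁻¹ * (K : ℝ≥0∞)).toReal) with hL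
  have hL0 : 0 ≤ L := ENNReal.toReal_nonneg
  have e : L * r ^ 2 = L / R ^ 2 * ρ ^ 2 := by
    rw [hr, div_pow]; field_simp
  rw [e]
  have hρ2 : 0 ≤ ρ ^ 2 := sq_nonneg ρ
  nlinarith

/-- **Local time-averaged Type-I dissipation of Morrey-Type-I frame solutions.**  Under the same hypotheses there
are `K, ρ₀ > 0` with `∫_{T-ρ²/ν}^{T} ∫_{B(x₀,ρ)} |∇u|² dx dt ≤ K ρ` for every centre `x₀` and every
`0 < ρ ≤ ρ₀` — `sup_{x₀, ρ} E((T,x₀), ρ) < ∞` for the CKN quantity `E(ρ) = ρ⁻¹ ∫∫_{Q_ρ} |∇u|²`.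
[cite: Seregin2006, Lemma 2.1 (c) (arXiv:math/0607537 §2)] [cite: CaffarelliKohnNirenberg1982, §2] -/
theorem exists_local_dissipation_of_morreyTypeINear (hν : 0 < ν) (hT : 0 < T)
    (hsol : IsClassicalNSSolutionOn (Ico 0 T) ν 0 u p) (hLH : IsLerayHopfOn T ν 0 (u 0) u)
    (hMor : MorreyTypeINear u T) :
    ∃ K : ℝ, 0 < K ∧ ∃ ρ₀ : ℝ, 0 < ρ₀ ∧ ∀ (x₀ : EuclideanSpace ℝ (Fin 3)) (ρ : ℝ), 0 < ρ → ρ ≤ ρ₀ →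
      ∫⁻ z in Ioo (T - ρ ^ 2 / ν) T ×ˢ ball x₀ ρ, ENNReal.ofReal (frobeniusNormSq (fderiv ℝ (u z.1) z.2)) ≤
        ENNReal.ofReal (K * ρ) := by
  obtain ⟨R, hRpos, -, K, hK⟩ := exists_zoom_sereginBounds_of_morreyTypeINear hν hT hsol hLH hMor
  set α : ℝ := R / ν with hα
  set β : ℝ := R ^ 2 / ν with hβdef
  have hαpos : 0 < α := by positivity
  have hβpos : 0 < β := by positivity
  -- the scaling constant of `E` under the zoom
  have hc0 : (ENNReal.ofReal ((α * R) ^ 2) * ENNReal.ofReal (β * R ^ 3)⁻¹ : ℝ≥0∞) ≠ 0 := by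
    refine mul_ne_zero ?_ ?_
    · exact (ENNReal.ofReal_pos.2 (by positivity)).ne'
    · exact (ENNReal.ofReal_pos.2 (by positivity)).ne'
  have hct : (ENNReal.ofReal ((α * R) ^ 2) * ENNReal.ofReal (β * R ^ 3)⁻¹ : ℝ≥0∞) ≠ ∞ :=
    ENNReal.mul_ne_top ENNReal.ofReal_ne_top ENNReal.ofReal_ne_top
  have hcK : ((ENNReal.ofReal ((α * R) ^ 2) * ENNReal.ofReal (β * R ^ 3)⁻¹)⁻¹ * (K : ℝ≥0∞)) ≠ ∞ :=
    ENNReal.mul_ne_top (ENNReal.inv_ne_top.2 hc0) ENNReal.coe_ne_top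
  set K' : ℝ := ((ENNReal.ofReal ((α * R) ^ 2) * ENNReal.ofReal (β * R ^ 3)⁻¹)⁻¹ * (K : ℝ≥0∞)).toReal / R + 1
    with hK'
  refine ⟨K', by positivity, R / 2, by positivity, fun x₀ ρ hρ hρR => ?_⟩
  set r : ℝ := ρ / R with hr
  have hrpos : 0 < r := by positivity
  have hrhalf : r ≤ 1 / 2 := by
    rw [hr, div_le_iff₀ hRpos]; linarith
  have hρeq : R * r = ρ := by rw [hr]; field_simp
  have hK' := hK x₀ r ⟨hrpos, hrhalf⟩
  have hE : cknE r 0 ((α * R) • stPull β R T x₀ fun t x => fderiv ℝ (u t) x) ≤ K :=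
    le_add_self.trans (le_self_add.trans (le_self_add.trans hK'))
  have hpre : parabolicCylinder r (0 : ℝ × EuclideanSpace ℝ (Fin 3)) =
      stAffine β R T x₀ ⁻¹' (Ioo (T - ρ ^ 2 / ν) T ×ˢ ball x₀ ρ) := by
    rw [← hρeq, hβdef, stAffine_preimage_cylinder_eq_parabolicCylinder hν hRpos T x₀ (R * r),
      mul_div_cancel_left₀ r hRpos.ne']
    rfl
  unfold cknE at hE
  rw [hpre, setLIntegral_frobeniusNormSq_stRescale hβpos hRpos T x₀ (α * R), finrank_euclideanSpace_fin] at hE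
  have ha0 : ENNReal.ofReal r ≠ 0 := (ENNReal.ofReal_pos.2 hrpos).ne'
  have hat : ENNReal.ofReal r ≠ ∞ := ENNReal.ofReal_ne_top
  have h1 := le_of_inv_mul_mul_le ha0 hat hc0 hct hE
  refine h1.trans ?_
  rw [← ENNReal.ofReal_toReal hcK, ← ENNReal.ofReal_mul ENNReal.toReal_nonneg]
  refine ENNReal.ofReal_le_ofReal ?_
  set L : ℝ := (((ENNReal.ofReal ((α * R) ^ 2) * ENNReal.ofReal (β * R ^ 3)⁻¹)⁻¹ * (K : ℝ≥0∞)).toReal)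
    with hL
  have hL0 : 0 ≤ L := ENNReal.toReal_nonneg
  have e : L * r = L / R * ρ := by
    rw [hr]; field_simp
  rw [e]
  nlinarith [hρ.le]

/-! ## §4  The same on the class of stub 2 (blow-up branch of the frame, Morrey-Type-I near `T`) -/

/-- **Stub 2's class has local time-averaged `L³`-Type-I pace.**  Exactly the hypotheses of the registered stub
`stub_morreyTypeI_slow` of line `pace` (the blow-up hypothesis and the decay of the datum are not even needed)
give `sup_{x₀, ρ ≤ ρ₀} ρ⁻² ∫_{T-ρ²/ν}^{T} ∫_{B(x₀,ρ)} |u|³ < ∞`.  The stub's conclusion `L3Slow u T` is the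
every-time, whole-space strengthening. [cite: Seregin2006, Lemma 2.1 (c) (arXiv:math/0607537 §2)] -/
theorem local_l3Pace_on_stub2_class :
    ∀ (ν T : ℝ), 0 < ν → 0 < T →
      ∀ (u : ℝ → EuclideanSpace ℝ (Fin 3) → EuclideanSpace ℝ (Fin 3)) (p : ℝ → EuclideanSpace ℝ (Fin 3) → ℝ),
        IsClassicalNSSolutionOn (Ico 0 T) ν 0 u p → IsLerayHopfOn T ν 0 (u 0) u →
        HasRapidSpatialDecay (u 0) → ¬ HasSmoothExtensionPast ν 0 u T → MorreyTypeINear u T →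
        ∃ K : ℝ, 0 < K ∧ ∃ ρ₀ : ℝ, 0 < ρ₀ ∧ ∀ (x₀ : EuclideanSpace ℝ (Fin 3)) (ρ : ℝ), 0 < ρ → ρ ≤ ρ₀ →
          ∫⁻ z in Ioo (T - ρ ^ 2 / ν) T ×ˢ ball x₀ ρ, ‖u z.1 z.2‖ₑ ^ (3 : ℕ) ≤ ENNReal.ofReal (K * ρ ^ 2) :=
  fun _ν _T hν hT _u _p hsol hLH _ _ hMor => exists_local_l3Pace_of_morreyTypeINear hν hT hsol hLH hMor

/-- **Stub 2's class has local time-averaged Type-I dissipation.** [cite: Seregin2006, Lemma 2.1 (c) (arXiv:math/0607537 §2)] -/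
theorem local_dissipation_on_stub2_class :
    ∀ (ν T : ℝ), 0 < ν → 0 < T →
      ∀ (u : ℝ → EuclideanSpace ℝ (Fin 3) → EuclideanSpace ℝ (Fin 3)) (p : ℝ → EuclideanSpace ℝ (Fin 3) → ℝ),
        IsClassicalNSSolutionOn (Ico 0 T) ν 0 u p → IsLerayHopfOn T ν 0 (u 0) u →
        HasRapidSpatialDecay (u 0) → ¬ HasSmoothExtensionPast ν 0 u T → MorreyTypeINear u T →
        ∃ K : ℝ, 0 < K ∧ ∃ ρ₀ : ℝ, 0 < ρ₀ ∧ ∀ (x₀ : EuclideanSpace ℝ (Fin 3)) (ρ : ℝ), 0 < ρ → ρ ≤ ρ₀ →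
          ∫⁻ z in Ioo (T - ρ ^ 2 / ν) T ×ˢ ball x₀ ρ, ENNReal.ofReal (frobeniusNormSq (fderiv ℝ (u z.1) z.2)) ≤
            ENNReal.ofReal (K * ρ) :=
  fun _ν _T hν hT _u _p hsol hLH _ _ hMor => exists_local_dissipation_of_morreyTypeINear hν hT hsol hLH hMor

end Summit.NavierStokesRegularity.NavierStokesRegularity.Theorems.L3TimeExponentPincerMorreyTypeILocalPace

end
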